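import Literature.MathematicalPhysics.QuantumFieldTheory.Balaban1983to89.T4AxialGaugeSmallField
import Literature.MathematicalPhysics.QuantumFieldTheory.Balaban1983to89.B16Eq18Proof

/-!
# BalabanUVNodes ∕ N12 — the WINDOW's coarse site count `#box_i` in N12's displayed threshold is a function of the instance's rows (print's condition (i): «Λ ⊂ cube of size 100M»)

Cell `pub-ymgap` (HUMAN RULINGS D-0062 ∕ D-0149), seat `pub-ymgap-dag-n12-d` g21 (R134 N12 [B15] s2); plan g90's in-lane (a)-display item (INBOX l.44572 «(a)-row display `#box_i ≤ f(M)`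
junction check against n12-d's `hBox∕hfit∕hWbox` (S)»), WANTED by the lane owner dag-n12-c g22 (INBOX l.44793); count-neutral helper of K1⁹ `stmt-QuantumFields-27364` (`--kind proof --supports …
--as helper`).  THEOREMS ONLY (0 `def`, 0 `instance`, 0 `sorry`); bookkeeping over `B16Eq18Proof.box` and `T4AxialGaugeSmallField.castSite` — nothing of Bałaban's asserted.

WHY (lane census `N12-UNIFORMITY-SPEC.md` §2 (a)).  N12's direct-road display («12Q∕12X-W-DIRECT» v9 p682012∕p682015, v10 `…WindowDirectOfClassOnlyRowL1…`) carries, in the Federbush term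
`Cτ_i = 16(d+1)(Kτ_i+1) + 8d·#box_i·(C_i·Kc_i)²` of the threshold `Θ P i`, the explicit count
`#box_i := ((box (fun κ => (hi P i κ − lo P i κ + 1).toNat + 3) (fun κ => lo P i κ − 2)).image castSite).card` — the number of coarse sites of the window box `[lo_i − 2, hi_i + 1]`
enlarged by three (= print's Λ in L^k-units plus a collar).  Print bounds it by condition (i) of [IV] (1.73) p.192 («Λ_i ⊂ a cube of size 100M»; [LF-II] p.358 «Λ is a rectangular
parallelepiped contained in a cube of the size 100M»).  The knit DISPLAYS, per run `P` and instance `i`, the rows `hn : hi ≤ lo + n`, `hbxM : 12·d·(n+2)² ≤ bx·M²` (and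
`hKn : (hi−lo+1).toNat ≤ Kb`), so `#box_i` IS ALREADY a function of the instance's `M_i` (the carrier's cube size, `InstOn.std … (M i)`) and the per-run scalar `bx`: THIS FILE records
the three inequalities a reader (or a later volume-bookkeeping edition) can cite — no new row is needed in the knit.

CONTENTS (namespace `Summit.QuantumFields.YangMills.BalabanUVNodes.N12WindowBoxCount`):
* `card_box_eq_prod` — `(box n y).card = ∏ κ, n κ`; `card_image_castSite_box_le` — the torus image has at most that many sites.
* ★ `card_windowBox_le_pow` — under `hn : ∀ κ, hi κ ≤ lo κ + n`: `#box ≤ (n + 4)^d`.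
* ★ `card_windowBox_le_pow_of_hKn` — under the Schur-size row `hKn : ∀ κ, (hi κ − lo κ + 1).toNat ≤ Kb`: `#box ≤ (Kb + 3)^d`.
* ★★ `card_windowBox_le_of_hbxM` — under `hn` and the knit's row `hbxM : 12·d·(n+2)² ≤ bx·M²` (`0 ≤ M`): `(#box : ℝ) ≤ (2·M·√(bx ∕ (12·d)))^d` — print-legitimate dependence
  on the instance's `M` ((a) of the census), the per-run `bx` being the knit's displayed numeric.

HONEST FRAMING ∕ LOCATED.  Finite counting; count-neutral; displays that one explicit count of N12's threshold is instance-size-controlled — it does NOT touch the large-field-REGION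
counts (`√#bonds(Ω₁(Z_i))` in the (K) row's inhabitant, census U2a) nor the torus plaquette count in `cA`∕`cJ′` (U3); N12 NOT discharged; K1⁹ NOT closed; counts unmoved; one finite
𝕋⁴ programme at fixed `ε = L^{-K}` — R4 closes only the conditional rung `BalabanLadder.UV`; nothing continuum ∕ ℝ⁴ ∕ OS ∕ mass gap ∕ Clay.

References: [Balaban1989LargeFieldI] CMP 122 (1989) 175–202, (1.73) p.192, Prop. 1 p.194; [Balaban1989LargeFieldII] CMP 122 (1989) 355–392, (1.8) p.358.
-/

noncomputable section

open Finset
open scoped BigOperators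

namespace Summit.QuantumFields.YangMills.BalabanUVNodes.N12WindowBoxCount

open Literature.MathematicalPhysics.QuantumFieldTheory.Balaban1983to89
open T4AxialGaugeSmallField (castSite)
open B16Eq18Proof (box mem_box)

variable {d : ℕ}

/-- `|Λ| = ∏ n_κ` for the rectangular parallelepiped `box n y`. [cite: Balaban1989LargeFieldII, (1.8) p.358 (bookkeeping)] -/
theorem card_box_eq_prod (n : Fin d → ℕ) (y : Fin d → ℤ) : (box n y).card = ∏ κ, n κ := by
  unfold B16Eq18Proof.box
  rw [Fintype.card_piFinset]
  exact Finset.prod_congr rfl fun κ _ => by rw [Int.card_Ico]; simp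

variable {P : Params} {j : ℕ}

/-- The torus image of a box has at most `∏ n_κ` sites. [cite: Balaban1989LargeFieldII, (1.8) p.358 (bookkeeping)] -/
theorem card_image_castSite_box_le (n : Fin P.d → ℕ) (y : Fin P.d → ℤ) :
    ((box n y).image (fun z => (castSite z : Site P j))).card ≤ ∏ κ, n κ :=
  Finset.card_image_le.trans (card_box_eq_prod n y).le

/-- ★ **THE WINDOW COUNT FROM THE SIDE ROW `hn`**: for the knit's window box (sides `(hi κ − lo κ + 1).toNat + 3`, corner `lo − 2`) and `hn : hi ≤ lo + n`,
`#box ≤ (n + 4)^d`. [cite: Balaban1989LargeFieldI, (1.73) p.192; Balaban1989LargeFieldII, (1.8) p.358 (bookkeeping)] -/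
theorem card_windowBox_le_pow (lo hi : Fin P.d → ℤ) (n : ℕ) (hn : ∀ κ, hi κ ≤ lo κ + n) :
    ((box (fun κ => (hi κ - lo κ + 1).toNat + 3) (fun κ => lo κ - 2)).image (fun z => (castSite z : Site P j))).card ≤ (n + 4) ^ P.d := by
  refine (card_image_castSite_box_le _ _).trans ?_
  calc ∏ κ, ((hi κ - lo κ + 1).toNat + 3) ≤ ∏ _κ : Fin P.d, (n + 4) :=
        Finset.prod_le_prod (fun _ _ => Nat.zero_le _) fun κ _ => by
          have h : (hi κ - lo κ + 1).toNat ≤ n + 1 := Int.toNat_le.2 (by push_cast; linarith [hn κ])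
          omega
    _ = (n + 4) ^ P.d := by rw [Finset.prod_const, Finset.card_univ, Fintype.card_fin]

/-- ★ **THE WINDOW COUNT FROM THE SCHUR-SIZE ROW `hKn`**: `(hi κ − lo κ + 1).toNat ≤ Kb` for all `κ` gives `#box ≤ (Kb + 3)^d`.
[cite: Balaban1989LargeFieldI, (1.73) p.192; Balaban1989LargeFieldII, (1.8) p.358 (bookkeeping)] -/
theorem card_windowBox_le_pow_of_hKn (lo hi : Fin P.d → ℤ) (Kb : ℕ) (hKn : ∀ κ, (hi κ - lo κ + 1).toNat ≤ Kb) :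
    ((box (fun κ => (hi κ - lo κ + 1).toNat + 3) (fun κ => lo κ - 2)).image (fun z => (castSite z : Site P j))).card ≤ (Kb + 3) ^ P.d := by
  refine (card_image_castSite_box_le _ _).trans ?_
  calc ∏ κ, ((hi κ - lo κ + 1).toNat + 3) ≤ ∏ _κ : Fin P.d, (Kb + 3) :=
        Finset.prod_le_prod (fun _ _ => Nat.zero_le _) fun κ _ => by have := hKn κ; omega
    _ = (Kb + 3) ^ P.d := by rw [Finset.prod_const, Finset.card_univ, Fintype.card_fin]

/-- ★★ **THE WINDOW COUNT IS CONTROLLED BY THE INSTANCE's `M` (print's condition (i))**: under the knit's rows `hn : hi ≤ lo + n` and `hbxM : 12·d·(n+2)² ≤ bx·M²` with `0 ≤ M`,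
`(#box : ℝ) ≤ (2·M·√(bx ∕ (12·d)))^d` — since `n + 4 ≤ 2(n+2) ≤ 2·M·√(bx∕(12d))`.  So the factor `#box_i` of the Federbush term `Cτ_i` in N12's displayed threshold depends on the
instance only through `M_i` (and the displayed per-run numeric `bx`), as print's «Λ ⊂ cube of size 100M» ((a) of the lane census).
[cite: Balaban1989LargeFieldI, (1.73) p.192, Prop. 1 p.194; Balaban1989LargeFieldII, (1.8) p.358 (bookkeeping)] -/
theorem card_windowBox_le_of_hbxM (hd : 0 < P.d) (lo hi : Fin P.d → ℤ) (n : ℕ) (hn : ∀ κ, hi κ ≤ lo κ + n) {bx M : ℝ} (hM : 0 ≤ M)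
    (hbxM : 12 * (P.d : ℝ) * ((n : ℝ) + 2) ^ 2 ≤ bx * M ^ 2) :
    (((box (fun κ => (hi κ - lo κ + 1).toNat + 3) (fun κ => lo κ - 2)).image (fun z => (castSite z : Site P j))).card : ℝ)
      ≤ (2 * M * Real.sqrt (bx / (12 * P.d))) ^ P.d := by
  have hd' : (0 : ℝ) < 12 * (P.d : ℝ) := by positivity
  -- `(n+2)² ≤ (bx/(12d))·M²`, hence `n + 2 ≤ M·√(bx/(12d))`
  have hsq : ((n : ℝ) + 2) ^ 2 ≤ bx / (12 * P.d) * M ^ 2 := by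
    rw [div_mul_eq_mul_div, le_div_iff₀ hd']
    linarith
  have hbx0 : 0 ≤ bx / (12 * P.d) := by
    have h1 : 0 ≤ bx / (12 * P.d) * M ^ 2 := le_trans (sq_nonneg _) hsq
    rcases eq_or_lt_of_le hM with h | h
    · -- `M = 0` forces `(n+2)² ≤ 0`, impossible; so this branch is vacuous
      exfalso; rw [← h] at hsq; have : (0:ℝ) < ((n : ℝ) + 2) ^ 2 := by positivity
      simp at hsq; linarith
    · exact nonneg_of_mul_nonneg_left h1 (by positivity)
  have hn2 : (n : ℝ) + 2 ≤ M * Real.sqrt (bx / (12 * P.d)) := by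
    have h := Real.sqrt_le_sqrt hsq
    rw [Real.sqrt_sq (by positivity), Real.sqrt_mul' _ (sq_nonneg M), Real.sqrt_sq hM] at h
    linarith [h, mul_comm (Real.sqrt (bx / (12 * P.d))) M]
  have hn4 : ((n : ℝ) + 4) ≤ 2 * M * Real.sqrt (bx / (12 * P.d)) := by nlinarith [hn2]
  calc (((box (fun κ => (hi κ - lo κ + 1).toNat + 3) (fun κ => lo κ - 2)).image (fun z => (castSite z : Site P j))).card : ℝ)
      ≤ (((n + 4) ^ P.d : ℕ) : ℝ) := by exact_mod_cast card_windowBox_le_pow lo hi n hn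
    _ = ((n : ℝ) + 4) ^ P.d := by push_cast; ring
    _ ≤ (2 * M * Real.sqrt (bx / (12 * P.d))) ^ P.d := pow_le_pow_left₀ (by positivity) hn4 _

end Summit.QuantumFields.YangMills.BalabanUVNodes.N12WindowBoxCount

end
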